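/-
Copyright (c) 2026 the pub-hodgecm-mathlib formalisation cell (harness21).  Prover seat hodgecm-mathlib-LH7-p09 (g2), CLOSE-OUT ROSTER strike line L3∕L5 (Track A
«(D-RAM) FOUR-FRAME» squad F0∕P3c∕LH4 ∕ F0∕P3c∕LH7); β₂-BOARD v2 row (OFF) (lead LH7-p09 (g2); β₂ WORD #22: the `hL_mix` assembly by the ω-flip — the FACE of the cell);
helper lane on h413 = stmt-HodgeConjecture-24833 (count-neutral).  2026-09-05.
-/
import Summits.HodgeConjecture.HodgeConjecture.Theorems.F0P3cDyRamLowerLineLabelFlip           -- ★ p863829 (this seat): the label flip for a PAIR of glued vertices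
import Summits.HodgeConjecture.HodgeConjecture.Theorems.F0P3cDyRamTubeCellGluedVertexExists     -- ★ FILE 15 (this seat): a glued vertex EXISTS over every tube-cell member below the conductor
import Summits.HodgeConjecture.HodgeConjecture.Theorems.F0P3cDyRamConeCellPresentation          -- ★ p862869 (this seat): the junction (its tools: `exists_tubeCoordinate`, …)
import HarnessLib

/-!
# Crux `H413`, line LH4 «(D-RAM) FOUR-FRAME» — the (β₂) road (R-36), β₂-BOARD v2 row (OFF), socket `hL_mix` (β₂ WORD #22): «THE ω-FACE OF A LOWER-LINE CELL BELOW THE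
# GLUE CONDUCTOR» — on a cell `(j, b)` of the lower line with `b + 1 ≤ d`, every ω-flip `ε` (`ε·Θε = jEξ₀`, `ξ₀` a `σ`-fixed non-norm UNIT) sends a `+`-labelled member `Λ`
# to a `¬+`-labelled member `ε·Λ` and a `¬+`-labelled `Λ` to a `+`-labelled `ε⁻¹·Λ` — the `hface` of ★ `…ConeCellFaceTube.finsum_levelSetDep_inter_weight_eq_of_face_exchange_of_succ_le`
# for the SHELL-FREE literals of ★ p863399

Cell `hodgecm-mathlib` (D-0151), FLOOR 0, crux item H413 = `stmt-HodgeConjecture-24833`, route of record `HCCMUnconditional`; squads F0∕P3c∕LH4 ∕ LH7; lane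
`--supports stmt-HodgeConjecture-24833 --as helper` (count-neutral; pays NO tier-0 row).  THEOREMS ONLY (no `def`, no instance, no notation, no `sorry`, default heartbeats);
★-only imports; states NO law; (β₂) stays a HYPOTHESIS.  Frame = ★ p862869's junction frame (block `(H₂, h_W)`, ★ (C1)'s line model) + the E-side wild datum
(`IsRamifiedQuadraticDatum σ ϖ d t`, `|2| < 1`, `[CompleteSpace E] [IsDiscreteValuationRing 𝒪[E]] [Finite 𝓀[E]]`) + the lower-line letters in the cell currency `cc = ϖE^j`.

WHY.  `hL_mix` (LH4-p12 (g8) ED. 6) at `b + 1 ≤ d` is ★ HEAD-lo's weighted exchange balance once its `hface` holds for the literals «∃ glued `L₃` with `VS = V₊`» ∕ «∃ glued `L₃` with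
`VS ≠ V₊`» (★ p863399 removed the shells).  THIS FILE proves that `hface`: ★ p860839 keeps `ε·Λ` in the cell, ★ FILE 15 gives a glued vertex over it, §1 presents BOTH glued
vertices on the generators `x₀` and `ε·x₀` (★ p862869's junction with a PRESCRIBED generator), and ★ p863829 reverses the label.
* §1 `exists_glueLetters_of_gen` — ★ p862869 `exists_presentation_of_mem_levelSetDep` with the generator `x₀` PRESCRIBED (any presentation of the member, not the membership witness).
* §2 HEAD `face_of_line_of_succ_le` — the exchange-form face on `levelSetDep(j, b; lam − jE u₀₀)` for every admissible flip with `Pf ε := ∃ ξ₀, ε·Θε = jE ξ₀ ∧ σξ₀ = ξ₀ ∧ ξ₀ ∉ N(E^×)`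
  (★ `exists_omegaFlip_admissible`'s predicate) and `|ε·Θε| = 1`.
HONEST LABEL.  Count-neutral composition; nothing printed is asserted; no census law is stated; `hL_mix` stays OPEN (the head over OFF.letter.v2's binders is the next file);
`HC_CM` is proved only modulo the 7 printed citations (2 remaining named inputs: hLiu418 = `stmt-HodgeConjecture-24832`, h413 = `stmt-HodgeConjecture-24833`) until rung 0 closes.
## References
* [Rogawski1990] J. D. Rogawski, *Automorphic Representations of Unitary Groups in Three Variables*, Ann. of Math. Stud. 123 (1990): §4.9 Prop. 4.9.1 (b) p. 55.
* [Jacobowitz1962] R. Jacobowitz, *Hermitian forms over local fields*, Amer. J. Math. 84 (1962): §4 (duals, modular components, gluing).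
* [BruhatTits1972] F. Bruhat, J. Tits, *Groupes réductifs sur un corps local I*, Publ. Math. IHÉS 41 (1972): §10.
* [Serre1979] J.-P. Serre, *Local Fields*, GTM 67 (1979): Ch. V §3 Cor. 3 (norm classes of units); Ch. III §3 Prop. 7.
* [Kottwitz1986BaseChangeUnits] R. E. Kottwitz, *Base change for unit elements of Hecke algebras*, Compositio Math. 60 (1986): §1 pp. 240–241.
-/

set_option autoImplicit false

noncomputable section

namespace Summit.HodgeConjecture.HodgeConjecture.Cruxes.H413.F0P3cDyRamLowerLineFlipFace

open scoped Valued WithZero Matrix MatrixGroups Pointwise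
open WithZero
open Literature.NumberTheory.Automorphic Literature.NumberTheory.Automorphic.HermitianLattice Literature.NumberTheory.Automorphic.UnitaryLatticeTree
open Literature.NumberTheory.Automorphic.UnitaryThreeFourFrame (IsRamifiedQuadraticDatum)
open Literature.NumberTheory.Automorphic.EllipticPlaneAsFieldLine
open Literature.NumberTheory.Rogawski1990
open Summit.HodgeConjecture.HodgeConjecture.Cruxes.H413.F0P3cDyRamFourFramePieces
open Summit.HodgeConjecture.HodgeConjecture.Cruxes.H413.F0P3cDyRamToricCensusDefs
open Summit.HodgeConjecture.HodgeConjecture.Cruxes.H413.F0P3cDyRamConeLevelTransport (exists_coneData_of_gen)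
open Summit.HodgeConjecture.HodgeConjecture.Cruxes.H413.F0P3cDyRamBlockGlueLabelFibreConstant (forall_v_apply_one_mul_le_of_tube)
open Summit.HodgeConjecture.HodgeConjecture.Cruxes.H413.F0P3cDyRamBoundaryCellLetterCardTwo (v_map_lt_one_iff_of_le_iff)
open Summit.HodgeConjecture.HodgeConjecture.Cruxes.H413.F0P3cDyRamConeWeightHalfSplit (dualGen_mul_left isOrd_mul_left_iff_of_fixed_unit)
open Summit.HodgeConjecture.HodgeConjecture.Cruxes.H413.F0P3cDyRamConeCellFlipBalance (smul_mem_levelSetDep_iff_of_flip)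
open Summit.HodgeConjecture.HodgeConjecture.Cruxes.H413.F0P3cDyRamLowerLineLabelFlip (valueSet_flip_of_line_sizes)
open Summit.HodgeConjecture.HodgeConjecture.Cruxes.H413.F0P3cDyRamTubeCellGluedVertexExists (exists_glued_of_mem_levelSetDep_of_succ_le)

variable {E M : Type} [Field E] [Valued E ℤᵐ⁰] [Field M] [Valued M ℤᵐ⁰] {ρ Θ : M →+* M} {α : M}

/-! ## §1 The junction with a prescribed generator -/

/-- **EVERY GLUED VERTEX OVER A PRESENTED CONE-CELL MEMBER HAS THE GLUE LETTERS ON THAT PRESENTATION** (★ p862869 `exists_presentation_of_mem_levelSetDep`, with the generator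
`x₀` of `Λ = x₀·𝒪_j` PRESCRIBED together with its order ∕ primitivity ∕ level ∕ depth clauses): there are `w₀`, `g₀` with `φ w₀ = Y⁻¹x₀` (`Y = dualGen … x₀`), `|x,₁|·|ϖ|^b ≤ 1` on `L`,
`g₀ ∈ L`, `|g₀,₁|·|ϖ|^b = 1`, `pr_W g₀ = ι_W w₀`. [cite: Jacobowitz1962, §4] [cite: BruhatTits1972, §10] [cite: Kottwitz1986BaseChangeUnits, §1 pp. 240–241] -/
theorem exists_glueLetters_of_gen
    (σ : E →+* E) (hσ : ∀ a, σ (σ a) = a) (hvσ : ∀ a, Valued.v (σ a) = Valued.v a) {ϖ : E} (hϖ : Valued.v ϖ = exp (-1 : ℤ))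
    {H₂ : Matrix (Fin 2) (Fin 2) E} (hH₂ : IsUnit H₂.det) (hH₂σ : (H₂.map σ)ᵀ = H₂) {hW : E} (hhW : Valued.v hW = 1)
    (jE : E →+* M) (hρρ : ∀ x, ρ (ρ x) = x) (hvρ : ∀ x, Valued.v (ρ x) = Valued.v x) (hα : ρ α ≠ α) (hα1 : Valued.v α ≤ 1)
    (hint : ∀ z : M, Valued.v z ≤ 1 → Valued.v ((z - ρ z) / (α - ρ α)) ≤ 1)
    (hΘΘ : ∀ x, Θ (Θ x) = x) (hΘρ : ∀ x, Θ (ρ x) = ρ (Θ x)) (hvΘ : ∀ x, Valued.v (Θ x) = Valued.v x)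
    (hjv : ∀ c, Valued.v (jE c) ≤ 1 ↔ Valued.v c ≤ 1) (hjfix : ∀ z, ρ z = z ↔ ∃ c, jE c = z)
    (hjpow : ∀ (t : E) (n : ℤ), Valued.v (jE t) = Valued.v (jE ϖ) ^ n ↔ Valued.v t = Valued.v ϖ ^ n)
    (hϖmax : ∀ t : M, ρ t = t → Valued.v t < 1 → Valued.v t ≤ Valued.v (jE ϖ))
    (φ : (Fin 2 → E) →+ M) (hφs : ∀ (c : E) (x : Fin 2 → E), φ (c • x) = jE c * φ x) (hφi : Function.Injective φ) (hφo : Function.Surjective φ)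
    {γ₂ : GL (Fin 2) E} {lam h : M} (hφγ : ∀ x, φ ((γ₂ : Matrix (Fin 2) (Fin 2) E).mulVec x) = lam * φ x) (hlam : Valued.v lam = 1)
    (hΘh : Θ h = h) (hh : h ≠ 0) (hform : ∀ x y, jE (pairing σ H₂ x y) = h * Θ (φ x) * φ y + ρ (h * Θ (φ x) * φ y))
    (u : E) {b : ℕ} (hb1 : 1 ≤ b) {j : ℕ} (hlamj : IsOrd ρ α (jE ϖ ^ j) lam)
    {Λ : AddSubgroup M} {x₀ : M} (hx₀ : x₀ ≠ 0) (hΛx : ∀ x, x ∈ Λ ↔ ∃ z, IsOrd ρ α (jE ϖ ^ j) z ∧ x = x₀ * z)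
    (hyO : IsOrd ρ α (jE ϖ ^ j) (dualGen ρ Θ α (jE ϖ ^ j) h x₀)) (hyp : ¬ IsOrd ρ α (jE ϖ ^ j) (dualGen ρ Θ α (jE ϖ ^ j) h x₀ / jE ϖ))
    (hylev : Valued.v (dualGen ρ Θ α (jE ϖ ^ j) h x₀) = Valued.v (jE ϖ) ^ b)
    (hdep : ∀ b', (∀ x ∈ Λ, Valued.v (h * Θ x * b' + ρ (h * Θ x * b')) ≤ 1) → (lam - jE u) * b' ∈ Λ)
    {B : Submodule 𝒪[E] (Fin 2 → E)} (hBΛ : B.toAddSubgroup.map φ = Λ)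
    {L : Submodule 𝒪[E] (Fin 3 → E)} (hL : IsSelfDualLattice σ ϖ (!![H₂ 0 0, 0, H₂ 0 1; 0, hW, 0; H₂ 1 0, 0, H₂ 1 1] : Matrix (Fin 3) (Fin 3) E) L)
    (hLB : L ⊓ LinearMap.ker ((LinearMap.proj (1 : Fin 3) : (Fin 3 → E) →ₗ[E] E).restrictScalars 𝒪[E]) =
      B.map ((Matrix.toLin' (!![1, 0; 0, 0; 0, 1] : Matrix (Fin 3) (Fin 2) E)).restrictScalars 𝒪[E]))
    (htube : ∀ c : E, (Pi.single 1 c : Fin 3 → E) ∈ L ↔ Valued.v c ≤ Valued.v ϖ ^ b) :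
    ∃ (w₀ : Fin 2 → E) (g₀ : Fin 3 → E), φ w₀ = (dualGen ρ Θ α (jE ϖ ^ j) h x₀)⁻¹ * x₀ ∧
      (∀ x ∈ L, Valued.v (x 1) * Valued.v ϖ ^ b ≤ 1) ∧ g₀ ∈ L ∧ Valued.v (g₀ 1) * Valued.v ϖ ^ b = 1 ∧
      g₀ - Pi.single 1 (g₀ 1) = ![w₀ 0, 0, w₀ 1] := by
  set H : Matrix (Fin 3) (Fin 3) E := !![H₂ 0 0, 0, H₂ 0 1; 0, hW, 0; H₂ 1 0, 0, H₂ 1 1] with hHdef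
  set ι := ((Matrix.toLin' (!![1, 0; 0, 0; 0, 1] : Matrix (Fin 3) (Fin 2) E)).restrictScalars 𝒪[E]) with hιdef
  have hHcol : ∀ l : Fin 3, l ≠ 1 → H l 1 = 0 := fun l hl => endoShapeForm_col H₂ hW l hl
  have hH₂h : ∀ a c : Fin 2, σ (H₂ a c) = H₂ c a := fun a c => by
    have e := congrFun (congrFun hH₂σ c) a
    rwa [Matrix.transpose_apply, Matrix.map_apply] at e
  have hsymm₂ : ∀ x y : Fin 2 → E, Valued.v (pairing σ H₂ y x) = Valued.v (pairing σ H₂ x y) := v_pairing_comm_of_hermitian hvσ hσ hH₂h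
  have hvϖ0 : Valued.v ϖ ≠ 0 := by rw [hϖ]; exact exp_ne_zero
  have hϖ0 : ϖ ≠ 0 := fun h0 => hvϖ0 (by rw [h0, map_zero])
  have hϖlt : Valued.v ϖ < 1 := by rw [hϖ, ← exp_zero, exp_lt_exp]; norm_num
  have hϖbpos : 0 < Valued.v ϖ ^ b := pow_pos (zero_lt_iff.2 hvϖ0) _
  have hιy : ∀ y : Fin 2 → E, ι y = ![y 0, 0, y 1] := fun y => by
    rw [hιdef, LinearMap.restrictScalars_apply, Matrix.toLin'_apply, planeMatrix_mulVec]
  -- `ι_W B ⊆ L`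
  have hιmem : ∀ y ∈ B, (![y 0, 0, y 1] : Fin 3 → E) ∈ L := fun y hy => by
    have h1 : ι y ∈ B.map ι := ⟨y, hy, rfl⟩
    rw [← hLB] at h1
    rw [← hιy]; exact h1.1
  -- the canonical cone data of `Λ`
  obtain ⟨B', hB'Λ, -, -, w₀, hw₀Y, hG1, hgen, hnorm, -⟩ :=
    exists_coneData_of_gen σ hϖ0 hϖlt H₂ jE hρρ hvρ hα hα1 hint hΘΘ hΘρ hvΘ hjv hjfix hjpow hϖmax φ hφs hφi hφo hφγ hlam hΘh hh hform u hb1 hx₀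
      hΛx hyO hyp hylev hdep hlamj
  have hBB' : B' = B := map_toAddSubgroup_injective φ hφi (hB'Λ.trans hBΛ.symm)
  subst hBB'
  -- tube data of `L` and a generator `x₁`
  have hpr : ∀ x ∈ L, Valued.v (x 1) * Valued.v ϖ ^ b ≤ 1 := forall_v_apply_one_mul_le_of_tube σ hvσ hϖ hH₂ hhW hL htube
  obtain ⟨b', hb', -, x₁, hx₁, hx₁1⟩ := exists_tubeCoordinate σ hvσ hϖ hH₂ hhW hL
  obtain ⟨hbb, -⟩ := tubeCoordinate_unique hϖ htube hb'
  subst hbb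
  -- the `W`-part of the generator, read on the plane
  set w : Fin 3 → E := x₁ - Pi.single 1 (x₁ 1) with hw
  have hw1 : w 1 = 0 := by simp [hw]
  set w₂ : Fin 2 → E := ![w 0, w 2] with hw₂
  have hwpl : w = ![w₂ 0, 0, w₂ 1] := by
    rw [eq_plane_of_apply_one_eq_zero hw1, hw₂]
    simp
  -- `w₂ ∈ B^♯` (self-duality of `L`, block pairing)
  have hLd : L ≤ dualLatt σ H L := le_dualLatt_of_isVertexLattice hvσ hL
  have hw₂d : w₂ ∈ dualLatt σ H₂ B' := by
    rw [mem_dualLatt]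
    intro y hy
    have h1 := (mem_dualLatt σ H L x₁).1 (hLd hx₁) _ (hιmem y hy)
    have e : pairing σ H ![y 0, 0, y 1] x₁ = pairing σ H₂ y w₂ := by
      have h2 := pairing_sub_single_right_of_block σ H 1 hHcol ![y 0, 0, y 1] x₁
      rw [← hw, hwpl, pairing_endoShapeForm_plane σ H₂ hW y w₂] at h2
      rw [h2]
      simp
    rwa [e] at h1
  -- `pr_W x₁ = t·w₀ + a`
  obtain ⟨t, a, ht, ha, hwta⟩ := hgen w₂ hw₂d
  -- the glue module of `L` has length exactly `2b`, so `t` is a unit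
  obtain ⟨-, hglue⟩ := exists_smul_add_of_tubeCoordinate σ hvσ hϖ hhW hL hb1 htube hpr hx₁ hx₁1
  have hw₀B : ∀ s : E, Valued.v s ≤ Valued.v ϖ ^ (2 * b) → s • w₀ ∈ B' := fun s hs => by
    have hs1 : Valued.v s ≤ 1 := hs.trans (pow_le_one₀ zero_le hϖlt.le)
    refine (hG1 (s • w₀)).2 ⟨?_, ?_⟩
    · rw [mem_dualLatt]
      intro y hy
      rw [map_smul, smul_eq_mul, Valuation.map_mul, hsymm₂]
      exact mul_le_one' hs1 ((hG1 y).1 hy).2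
    · rw [map_smul, smul_eq_mul, Valuation.map_mul]
      calc Valued.v s * Valued.v (pairing σ H₂ w₀ w₀) ≤ Valued.v ϖ ^ (2 * b) * Valued.v (pairing σ H₂ w₀ w₀) := mul_le_mul_left hs _
        _ = 1 := by rw [mul_comm]; exact hnorm
  have ht1 : Valued.v t = 1 := by
    by_contra hne
    have htlt : Valued.v t < 1 := lt_of_le_of_ne ht hne
    have htϖ : Valued.v t ≤ Valued.v ϖ := by
      have hx := WithZero.lt_mul_exp_iff_le (x := Valued.v t) (y := exp (-1 : ℤ)) exp_ne_zero
      rw [← exp_add, show (-1 : ℤ) + 1 = 0 by norm_num, exp_zero] at hx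
      rw [hϖ]; exact hx.1 htlt
    -- `ϖ^{2b−1}·pr_W x₁ ∈ L`
    have hmem : ϖ ^ (2 * b - 1) • (x₁ - Pi.single 1 (x₁ 1)) ∈ L := by
      have e : ϖ ^ (2 * b - 1) • (x₁ - Pi.single 1 (x₁ 1)) =
          (![((ϖ ^ (2 * b - 1) * t) • w₀) 0, 0, ((ϖ ^ (2 * b - 1) * t) • w₀) 1] : Fin 3 → E) +
            ![(ϖ ^ (2 * b - 1) • a) 0, 0, (ϖ ^ (2 * b - 1) • a) 1] := by
        rw [← hw, hwpl, hwta]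
        ext i; fin_cases i <;> simp [mul_add, mul_assoc]
      rw [e]
      refine L.add_mem (hιmem _ (hw₀B _ ?_)) (hιmem _ (B'.smul_mem (⟨ϖ ^ (2 * b - 1), ?_⟩ : 𝒪[E]) ha))
      · rw [Valuation.map_mul, Valuation.map_pow]
        calc Valued.v ϖ ^ (2 * b - 1) * Valued.v t ≤ Valued.v ϖ ^ (2 * b - 1) * Valued.v ϖ := mul_le_mul_right htϖ _
          _ = Valued.v ϖ ^ (2 * b) := by rw [← pow_succ]; congr 1; omega
      · rw [Valuation.mem_integer_iff, Valuation.map_pow]; exact pow_le_one₀ zero_le hϖlt.le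
    have hle := (hglue (ϖ ^ (2 * b - 1))).1 hmem
    rw [Valuation.map_pow] at hle
    have hlt : Valued.v ϖ ^ (2 * b) < Valued.v ϖ ^ (2 * b - 1) := pow_lt_pow_right_of_lt_one₀ (zero_lt_iff.2 hvϖ0) hϖlt (by omega)
    exact absurd (lt_of_lt_of_le hlt hle) (lt_irrefl _)
  have ht0 : t ≠ 0 := fun h0 => by rw [h0, map_zero] at ht1; exact zero_ne_one ht1
  -- concrete coordinates of the generator
  obtain ⟨p, q, r, hx₁v⟩ : ∃ p q r : E, x₁ = ![p, q, r] := ⟨x₁ 0, x₁ 1, x₁ 2, by ext i; fin_cases i <;> rfl⟩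
  subst hx₁v
  have hp : p = t * w₀ 0 + a 0 := by
    have e := congrFun hwpl 0
    rw [hw, hwta] at e
    simpa using e
  have hr : r = t * w₀ 1 + a 1 := by
    have e := congrFun hwpl 2
    rw [hw, hwta] at e
    simpa using e
  have hq1 : Valued.v q * Valued.v ϖ ^ b = 1 := by simpa using hx₁1
  refine ⟨w₀, ![w₀ 0, t⁻¹ * q, w₀ 1], hw₀Y, hpr, ?_, ?_, ?_⟩
  · have e : (![w₀ 0, t⁻¹ * q, w₀ 1] : Fin 3 → E) = t⁻¹ • ((![p, q, r] : Fin 3 → E) - ![a 0, 0, a 1]) := by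
      ext i
      fin_cases i
      · simp [hp, ht0]
      · simp
      · simp [hr, ht0]
    rw [e]
    exact L.smul_mem (⟨t⁻¹, by rw [Valuation.mem_integer_iff, map_inv₀, ht1, inv_one]⟩ : 𝒪[E]) (L.sub_mem hx₁ (hιmem a ha))
  · have e : (![w₀ 0, t⁻¹ * q, w₀ 1] : Fin 3 → E) 1 = t⁻¹ * q := by simp
    rw [e, Valuation.map_mul, map_inv₀, ht1, inv_one, one_mul, hq1]
  · ext i
    fin_cases i <;> simp

/-! ## §2 HEAD — the exchange-form face of a lower-line cell below the glue conductor -/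

/-- **HEAD — «THE ω-FACE OF A LOWER-LINE CELL BELOW THE GLUE CONDUCTOR».**  Junction frame (block `(H₂, h_W)`, `H₂` hermitian of unit determinant, ★ (C1)'s line model,
`jE` isometric, `Θ ∘ jE = jE ∘ σ`), E-side wild datum with `[CompleteSpace E] [IsDiscreteValuationRing 𝒪[E]] [Finite 𝓀[E]]`, the literal's `u : GL (Fin 1) E` with `u₀₀·σu₀₀ = 1`,
`Θlam·lam = 1`, `|lam| = 1`; the cell `(j, b)` with `1 ≤ b < j`, `b + 1 ≤ d`, `lam ∈ 𝒪_j`; the LOWER-LINE letters in the cell currency `cc = ϖE^j` (`hμle hanti g1 g2 g3 gsk hlamn hun`,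
as in ★ p863829).  THEN for every flip `ε` with `ε·Θε = jE ξ₀`, `ξ₀` `σ`-fixed and not a norm, and `|ε·Θε| = 1`:
(→) a member `Λ` of `levelSetDep(j, b; lam − jE u₀₀)` carrying a glued vertex of label `+` has `ε·Λ` carrying a glued vertex of label `¬+`;
(←) a member carrying a glued vertex of label `¬+` has `ε⁻¹·Λ` carrying a glued vertex of label `+` — the `hface` of ★ `…ConeCellFaceTube`'s weighted exchange head for the
shell-free literals of ★ p863399. [cite: Rogawski1990, §4.9 Prop. 4.9.1 (b) p. 55] [cite: Serre1979, Ch. V §3 Cor. 3] [cite: Jacobowitz1962, §4] [cite: Kottwitz1986BaseChangeUnits, §1 pp. 240–241] -/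
theorem face_of_line_of_succ_le [CompleteSpace E] [IsDiscreteValuationRing 𝒪[E]] [Finite 𝓀[E]]
    (σ : E →+* E) (hσ : ∀ a, σ (σ a) = a) (hvσ : ∀ a, Valued.v (σ a) = Valued.v a) {ϖ : E} (hϖ : Valued.v ϖ = exp (-1 : ℤ))
    {d t : ℕ} (hD : IsRamifiedQuadraticDatum σ ϖ d t) (h2v : Valued.v (2 : E) < 1)
    {H₂ : Matrix (Fin 2) (Fin 2) E} (hH₂ : IsUnit H₂.det) (hH₂σ : (H₂.map σ)ᵀ = H₂) {hW : E} (hhW : Valued.v hW = 1) (hhWσ : σ hW = hW)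
    (jE : E →+* M) (hρρ : ∀ x, ρ (ρ x) = x) (hvρ : ∀ x, Valued.v (ρ x) = Valued.v x) (hα : ρ α ≠ α) (hα1 : Valued.v α ≤ 1)
    (hint : ∀ z : M, Valued.v z ≤ 1 → Valued.v ((z - ρ z) / (α - ρ α)) ≤ 1)
    (hΘΘ : ∀ x, Θ (Θ x) = x) (hΘρ : ∀ x, Θ (ρ x) = ρ (Θ x)) (hvΘ : ∀ x, Valued.v (Θ x) = Valued.v x) (hΘj : ∀ c, Θ (jE c) = jE (σ c))
    (hjv : ∀ c, Valued.v (jE c) ≤ 1 ↔ Valued.v c ≤ 1) (hjiso : ∀ c, Valued.v (jE c) = Valued.v c) (hjfix : ∀ z, ρ z = z ↔ ∃ c, jE c = z)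
    (hjpow : ∀ (t : E) (n : ℤ), Valued.v (jE t) = Valued.v (jE ϖ) ^ n ↔ Valued.v t = Valued.v ϖ ^ n)
    (hϖmax : ∀ t : M, ρ t = t → Valued.v t < 1 → Valued.v t ≤ Valued.v (jE ϖ))
    (φ : (Fin 2 → E) →+ M) (hφs : ∀ (c : E) (x : Fin 2 → E), φ (c • x) = jE c * φ x) (hφi : Function.Injective φ) (hφo : Function.Surjective φ)
    {γ₂ : GL (Fin 2) E} {lam h : M} (hφγ : ∀ x, φ ((γ₂ : Matrix (Fin 2) (Fin 2) E).mulVec x) = lam * φ x) (hlam : Valued.v lam = 1)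
    (hΘh : Θ h = h) (hh : h ≠ 0) (hform : ∀ x y, jE (pairing σ H₂ x y) = h * Θ (φ x) * φ y + ρ (h * Θ (φ x) * φ y))
    (u : GL (Fin 1) E) {b j : ℕ} (hb1 : 1 ≤ b) (hbj : b < j) (hbd : b + 1 ≤ d) (hlamj : IsOrd ρ α (jE ϖ ^ j) lam)
    -- the LOWER-LINE letters in the cell currency `cc = ϖE^j`
    (hμle : Valued.v (lam - jE ((u : Matrix (Fin 1) (Fin 1) E) 0 0)) ≤ Valued.v (jE ϖ) ^ (2 * b + d % 2 + 1))
    (hanti : Valued.v ((lam - jE ((u : Matrix (Fin 1) (Fin 1) E) 0 0)) - ρ (lam - jE ((u : Matrix (Fin 1) (Fin 1) E) 0 0))) =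
      Valued.v (jE ϖ ^ j * (α - ρ α)) * Valued.v (jE ϖ) ^ (b + d % 2))
    (g1 : Valued.v (lam - jE ((u : Matrix (Fin 1) (Fin 1) E) 0 0)) * Valued.v (jE ϖ) ^ (d - 1) ≤
      Valued.v (α - ρ α) * Valued.v (jE ϖ) ^ b * Valued.v (jE ϖ) ^ mstarOfRecord d)
    (g2 : Valued.v (lam - jE ((u : Matrix (Fin 1) (Fin 1) E) 0 0)) * Valued.v (Θ α - α) ≤
      Valued.v (α - ρ α) * Valued.v (jE ϖ) ^ b * Valued.v (jE ϖ) ^ mstarOfRecord d)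
    (g3 : Valued.v (lam - jE ((u : Matrix (Fin 1) (Fin 1) E) 0 0)) * Valued.v (jE ϖ ^ j) ≤
      Valued.v (α - ρ α) * Valued.v (jE ϖ) ^ b * Valued.v (jE ϖ) ^ mstarOfRecord d)
    {n : ℕ} (hn : 3 * d - 2 + d % 2 ≤ n)
    (gsk : Valued.v (lam - jE ((u : Matrix (Fin 1) (Fin 1) E) 0 0)) * Valued.v ((lam - jE ((u : Matrix (Fin 1) (Fin 1) E) 0 0)) - ρ (lam - jE ((u : Matrix (Fin 1) (Fin 1) E) 0 0))) ≤
      Valued.v (jE ϖ) ^ n * Valued.v (jE ϖ ^ j * (α - ρ α)) * Valued.v (jE ϖ) ^ b)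
    (hΘlam : Θ lam * lam = 1) (hvlam : Valued.v lam = 1)
    (huu : ((u : Matrix (Fin 1) (Fin 1) E) 0 0) * σ ((u : Matrix (Fin 1) (Fin 1) E) 0 0) = 1)
    (hlamn : Valued.v (lam - 1) ≤ Valued.v (jE ϖ) ^ n) (hun : Valued.v ((u : Matrix (Fin 1) (Fin 1) E) 0 0 - 1) ≤ Valued.v ϖ ^ n) :
    ∀ (ε ξ : M), (∃ ξ₀ : E, ε * Θ ε = jE ξ₀ ∧ σ ξ₀ = ξ₀ ∧ ¬ ∃ e : E, e * σ e = ξ₀) → ε * Θ ε = ξ → ρ ξ = ξ → Valued.v ξ = 1 →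
      (∀ Λ ∈ levelSetDep ρ Θ α (jE ϖ) h j b (lam - jE ((u : Matrix (Fin 1) (Fin 1) E) 0 0)),
        (∃ B : Submodule 𝒪[E] (Fin 2 → E), B.toAddSubgroup.map φ = Λ ∧
          ∃ L₃ : Submodule 𝒪[E] (Fin 3 → E), IsSelfDualLattice σ ϖ (!![H₂ 0 0, 0, H₂ 0 1; 0, hW, 0; H₂ 1 0, 0, H₂ 1 1] : Matrix (Fin 3) (Fin 3) E) L₃ ∧
            L₃ ⊓ LinearMap.ker ((LinearMap.proj (1 : Fin 3) : (Fin 3 → E) →ₗ[E] E).restrictScalars 𝒪[E]) =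
              B.map ((Matrix.toLin' (!![1, 0; 0, 0; 0, 1] : Matrix (Fin 3) (Fin 2) E)).restrictScalars 𝒪[E]) ∧
            (∀ c : E, (Pi.single 1 c : Fin 3 → E) ∈ L₃ ↔ Valued.v c ≤ Valued.v ϖ ^ b) ∧
            {z : E | ∃ y ∈ L₃, Valued.v ((ϖ ^ mstarOfRecord d)⁻¹ * (z - pairing σ (!![H₂ 0 0, 0, H₂ 0 1; 0, hW, 0; H₂ 1 0, 0, H₂ 1 1] : Matrix (Fin 3) (Fin 3) E) y
          ((((endoGL (γ₂, u) : GL (Fin 3) E) : Matrix (Fin 3) (Fin 3) E) - 1) *ᵥ y))) ≤ 1} = valueSetMod σ ϖ (mstarOfRecord d) (xPlus σ ϖ d)) →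
        (∃ B : Submodule 𝒪[E] (Fin 2 → E), B.toAddSubgroup.map φ = ε • Λ ∧
          ∃ L₃ : Submodule 𝒪[E] (Fin 3 → E), IsSelfDualLattice σ ϖ (!![H₂ 0 0, 0, H₂ 0 1; 0, hW, 0; H₂ 1 0, 0, H₂ 1 1] : Matrix (Fin 3) (Fin 3) E) L₃ ∧
            L₃ ⊓ LinearMap.ker ((LinearMap.proj (1 : Fin 3) : (Fin 3 → E) →ₗ[E] E).restrictScalars 𝒪[E]) =
              B.map ((Matrix.toLin' (!![1, 0; 0, 0; 0, 1] : Matrix (Fin 3) (Fin 2) E)).restrictScalars 𝒪[E]) ∧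
            (∀ c : E, (Pi.single 1 c : Fin 3 → E) ∈ L₃ ↔ Valued.v c ≤ Valued.v ϖ ^ b) ∧
            ¬ {z : E | ∃ y ∈ L₃, Valued.v ((ϖ ^ mstarOfRecord d)⁻¹ * (z - pairing σ (!![H₂ 0 0, 0, H₂ 0 1; 0, hW, 0; H₂ 1 0, 0, H₂ 1 1] : Matrix (Fin 3) (Fin 3) E) y
          ((((endoGL (γ₂, u) : GL (Fin 3) E) : Matrix (Fin 3) (Fin 3) E) - 1) *ᵥ y))) ≤ 1} = valueSetMod σ ϖ (mstarOfRecord d) (xPlus σ ϖ d))) ∧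
      (∀ Λ ∈ levelSetDep ρ Θ α (jE ϖ) h j b (lam - jE ((u : Matrix (Fin 1) (Fin 1) E) 0 0)),
        (∃ B : Submodule 𝒪[E] (Fin 2 → E), B.toAddSubgroup.map φ = Λ ∧
          ∃ L₃ : Submodule 𝒪[E] (Fin 3 → E), IsSelfDualLattice σ ϖ (!![H₂ 0 0, 0, H₂ 0 1; 0, hW, 0; H₂ 1 0, 0, H₂ 1 1] : Matrix (Fin 3) (Fin 3) E) L₃ ∧
            L₃ ⊓ LinearMap.ker ((LinearMap.proj (1 : Fin 3) : (Fin 3 → E) →ₗ[E] E).restrictScalars 𝒪[E]) =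
              B.map ((Matrix.toLin' (!![1, 0; 0, 0; 0, 1] : Matrix (Fin 3) (Fin 2) E)).restrictScalars 𝒪[E]) ∧
            (∀ c : E, (Pi.single 1 c : Fin 3 → E) ∈ L₃ ↔ Valued.v c ≤ Valued.v ϖ ^ b) ∧
            ¬ {z : E | ∃ y ∈ L₃, Valued.v ((ϖ ^ mstarOfRecord d)⁻¹ * (z - pairing σ (!![H₂ 0 0, 0, H₂ 0 1; 0, hW, 0; H₂ 1 0, 0, H₂ 1 1] : Matrix (Fin 3) (Fin 3) E) y
          ((((endoGL (γ₂, u) : GL (Fin 3) E) : Matrix (Fin 3) (Fin 3) E) - 1) *ᵥ y))) ≤ 1} = valueSetMod σ ϖ (mstarOfRecord d) (xPlus σ ϖ d)) →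
        (∃ B : Submodule 𝒪[E] (Fin 2 → E), B.toAddSubgroup.map φ = ε⁻¹ • Λ ∧
          ∃ L₃ : Submodule 𝒪[E] (Fin 3 → E), IsSelfDualLattice σ ϖ (!![H₂ 0 0, 0, H₂ 0 1; 0, hW, 0; H₂ 1 0, 0, H₂ 1 1] : Matrix (Fin 3) (Fin 3) E) L₃ ∧
            L₃ ⊓ LinearMap.ker ((LinearMap.proj (1 : Fin 3) : (Fin 3 → E) →ₗ[E] E).restrictScalars 𝒪[E]) =
              B.map ((Matrix.toLin' (!![1, 0; 0, 0; 0, 1] : Matrix (Fin 3) (Fin 2) E)).restrictScalars 𝒪[E]) ∧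
            (∀ c : E, (Pi.single 1 c : Fin 3 → E) ∈ L₃ ↔ Valued.v c ≤ Valued.v ϖ ^ b) ∧
            {z : E | ∃ y ∈ L₃, Valued.v ((ϖ ^ mstarOfRecord d)⁻¹ * (z - pairing σ (!![H₂ 0 0, 0, H₂ 0 1; 0, hW, 0; H₂ 1 0, 0, H₂ 1 1] : Matrix (Fin 3) (Fin 3) E) y
          ((((endoGL (γ₂, u) : GL (Fin 3) E) : Matrix (Fin 3) (Fin 3) E) - 1) *ᵥ y))) ≤ 1} = valueSetMod σ ϖ (mstarOfRecord d) (xPlus σ ϖ d))) := by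
  have hvϖ0 : Valued.v ϖ ≠ 0 := by rw [hϖ]; exact exp_ne_zero
  have hϖ0 : ϖ ≠ 0 := fun h0 => hvϖ0 (by rw [h0, map_zero])
  have hϖlt : Valued.v ϖ < 1 := by rw [hϖ, ← exp_zero, exp_lt_exp]; norm_num
  have hjϖ0 : jE ϖ ≠ 0 := (map_ne_zero jE).2 hϖ0
  have hjϖlt : Valued.v (jE ϖ) < 1 := (v_map_lt_one_iff_of_le_iff jE hjv ϖ).2 hϖlt
  have hρϖ : ρ (jE ϖ) = jE ϖ := (hjfix _).2 ⟨ϖ, rfl⟩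
  have hα0 : α - ρ α ≠ 0 := sub_ne_zero.2 (Ne.symm hα)
  -- the cell letters `cc = ϖE^j`
  have hc : ρ (jE ϖ ^ j) = jE ϖ ^ j := by rw [map_pow, hρϖ]
  have hc0 : jE ϖ ^ j ≠ 0 := pow_ne_zero j hjϖ0
  have hc1 : Valued.v (jE ϖ ^ j) ≤ 1 := by rw [Valuation.map_pow]; exact pow_le_one₀ zero_le hjϖlt.le
  have hcc : jE ϖ ^ j * (α - ρ α) ≠ 0 := mul_ne_zero hc0 hα0
  have hcb : Valued.v (jE ϖ ^ j) < Valued.v (jE ϖ) ^ b := by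
    rw [Valuation.map_pow]; exact pow_lt_pow_right_of_lt_one₀ (zero_lt_iff.2 ((Valuation.ne_zero_iff _).2 hjϖ0)) hjϖlt hbj
  set H : Matrix (Fin 3) (Fin 3) E := !![H₂ 0 0, 0, H₂ 0 1; 0, hW, 0; H₂ 1 0, 0, H₂ 1 1] with hHdef
  set μ : M := lam - jE ((u : Matrix (Fin 1) (Fin 1) E) 0 0) with hμdef
  -- the form is integral on a self-dual lattice
  have hintL : ∀ L : Submodule 𝒪[E] (Fin 3 → E), IsSelfDualLattice σ ϖ H L → ∀ y ∈ L, Valued.v (pairing σ H y y) ≤ 1 :=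
    fun L hL y hy => (mem_dualLatt σ H L y).1 (le_dualLatt_of_isVertexLattice hvσ hL hy) y hy
  -- KEY: for a flip `ε′` and glued vertices over `Λ` and `ε′ • Λ`, the labels are opposite
  have key : ∀ (ε' : M) (ξ₀' : E), ε' * Θ ε' = jE ξ₀' → σ ξ₀' = ξ₀' → Valued.v ξ₀' = 1 → (¬ ∃ e : E, e * σ e = ξ₀') →
      ∀ Λ ∈ levelSetDep ρ Θ α (jE ϖ) h j b μ,
      ∀ (B : Submodule 𝒪[E] (Fin 2 → E)) (L₃ : Submodule 𝒪[E] (Fin 3 → E)), B.toAddSubgroup.map φ = Λ → IsSelfDualLattice σ ϖ H L₃ →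
        L₃ ⊓ LinearMap.ker ((LinearMap.proj (1 : Fin 3) : (Fin 3 → E) →ₗ[E] E).restrictScalars 𝒪[E]) = B.map ((Matrix.toLin' (!![1, 0; 0, 0; 0, 1] : Matrix (Fin 3) (Fin 2) E)).restrictScalars 𝒪[E]) →
        (∀ c : E, (Pi.single 1 c : Fin 3 → E) ∈ L₃ ↔ Valued.v c ≤ Valued.v ϖ ^ b) →
      ∀ (B' : Submodule 𝒪[E] (Fin 2 → E)) (L₃' : Submodule 𝒪[E] (Fin 3 → E)), B'.toAddSubgroup.map φ = ε' • Λ → IsSelfDualLattice σ ϖ H L₃' →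
        L₃' ⊓ LinearMap.ker ((LinearMap.proj (1 : Fin 3) : (Fin 3 → E) →ₗ[E] E).restrictScalars 𝒪[E]) = B'.map ((Matrix.toLin' (!![1, 0; 0, 0; 0, 1] : Matrix (Fin 3) (Fin 2) E)).restrictScalars 𝒪[E]) →
        (∀ c : E, (Pi.single 1 c : Fin 3 → E) ∈ L₃' ↔ Valued.v c ≤ Valued.v ϖ ^ b) →
      ({z : E | ∃ y ∈ L₃, Valued.v ((ϖ ^ mstarOfRecord d)⁻¹ * (z - pairing σ (!![H₂ 0 0, 0, H₂ 0 1; 0, hW, 0; H₂ 1 0, 0, H₂ 1 1] : Matrix (Fin 3) (Fin 3) E) y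
          ((((endoGL (γ₂, u) : GL (Fin 3) E) : Matrix (Fin 3) (Fin 3) E) - 1) *ᵥ y))) ≤ 1} = valueSetMod σ ϖ (mstarOfRecord d) (xPlus σ ϖ d) ↔
        ¬ {z : E | ∃ y ∈ L₃', Valued.v ((ϖ ^ mstarOfRecord d)⁻¹ * (z - pairing σ (!![H₂ 0 0, 0, H₂ 0 1; 0, hW, 0; H₂ 1 0, 0, H₂ 1 1] : Matrix (Fin 3) (Fin 3) E) y
          ((((endoGL (γ₂, u) : GL (Fin 3) E) : Matrix (Fin 3) (Fin 3) E) - 1) *ᵥ y))) ≤ 1} = valueSetMod σ ϖ (mstarOfRecord d) (xPlus σ ϖ d)) := by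
    intro ε' ξ₀' hε' hσ' h1' hN' Λ hΛ B L₃ hBΛ hL hLB htube B' L₃' hB'Λ' hL' hLB' htube'
    have hρ' : ρ (jE ξ₀') = jE ξ₀' := (hjfix _).2 ⟨ξ₀', rfl⟩
    have h1M' : Valued.v (jE ξ₀') = 1 := by rw [hjiso, h1']
    have hj0' : jE ξ₀' ≠ 0 := fun h0 => by rw [h0, map_zero] at h1M'; exact zero_ne_one h1M'
    have hε0' : ε' ≠ 0 := fun h0 => hj0' (by rw [← hε', h0, zero_mul])
    obtain ⟨⟨x₀, hx₀, hΛx, hyO, hyp, hylev⟩, hdep⟩ := hΛ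
    -- glue letters of `L₃` on `x₀`
    obtain ⟨w₀, g₀, hw₀Y, hpr, hg₀, hg₀1, hprg⟩ := exists_glueLetters_of_gen σ hσ hvσ hϖ hH₂ hH₂σ hhW jE hρρ hvρ hα hα1 hint hΘΘ hΘρ hvΘ hjv hjfix hjpow hϖmax
      φ hφs hφi hφo hφγ hlam hΘh hh hform ((u : Matrix (Fin 1) (Fin 1) E) 0 0) hb1 hlamj hx₀ hΛx hyO hyp hylev hdep hBΛ hL hLB htube
    -- the flipped presentation on `ε′·x₀`
    have hx₀' : ε' * x₀ ≠ 0 := mul_ne_zero hε0' hx₀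
    have hY' : dualGen ρ Θ α (jE ϖ ^ j) h (ε' * x₀) = jE ξ₀' * dualGen ρ Θ α (jE ϖ ^ j) h x₀ := dualGen_mul_left hε' (jE ϖ ^ j) h x₀
    have hyO' : IsOrd ρ α (jE ϖ ^ j) (dualGen ρ Θ α (jE ϖ ^ j) h (ε' * x₀)) := by
      rw [hY']; exact (isOrd_mul_left_iff_of_fixed_unit hρ' h1M' (jE ϖ ^ j) _).2 hyO
    have hyp' : ¬ IsOrd ρ α (jE ϖ ^ j) (dualGen ρ Θ α (jE ϖ ^ j) h (ε' * x₀) / jE ϖ) := by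
      rw [hY', mul_div_assoc, isOrd_mul_left_iff_of_fixed_unit hρ' h1M' (jE ϖ ^ j)]; exact hyp
    have hylev' : Valued.v (dualGen ρ Θ α (jE ϖ ^ j) h (ε' * x₀)) = Valued.v (jE ϖ) ^ b := by rw [hY', Valuation.map_mul, h1M', one_mul, hylev]
    have hΛx' : ∀ x, x ∈ ε' • Λ ↔ ∃ z, IsOrd ρ α (jE ϖ ^ j) z ∧ x = ε' * x₀ * z := by
      intro x
      rw [AddSubgroup.mem_smul_pointwise_iff_exists]
      constructor
      · rintro ⟨y, hy, rfl⟩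
        obtain ⟨z, hz, rfl⟩ := (hΛx y).1 hy
        exact ⟨z, hz, by rw [smul_eq_mul, mul_assoc]⟩
      · rintro ⟨z, hz, rfl⟩
        exact ⟨x₀ * z, (hΛx _).2 ⟨z, hz, rfl⟩, by rw [smul_eq_mul, mul_assoc]⟩
    have hΛ' : ε' • Λ ∈ levelSetDep ρ Θ α (jE ϖ) h j b μ :=
      (smul_mem_levelSetDep_iff_of_flip hε' hρ' h1M' (jE ϖ) h j b μ Λ).2 ⟨⟨x₀, hx₀, hΛx, hyO, hyp, hylev⟩, hdep⟩
    obtain ⟨w₀', g₀', hw₀Y', hpr', hg₀', hg₀1', hprg'⟩ := exists_glueLetters_of_gen σ hσ hvσ hϖ hH₂ hH₂σ hhW jE hρρ hvρ hα hα1 hint hΘΘ hΘρ hvΘ hjv hjfix hjpow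
      hϖmax φ hφs hφi hφo hφγ hlam hΘh hh hform ((u : Matrix (Fin 1) (Fin 1) E) 0 0) hb1 hlamj hx₀' hΛx' hyO' hyp' hylev' hΛ'.2 hB'Λ' hL' hLB' htube'
    -- the ray scalar of the base vertex
    have hfix : ρ (μ / (jE ϖ ^ j * (α - ρ α) * Θ (dualGen ρ Θ α (jE ϖ ^ j) h x₀)) + ρ (μ / (jE ϖ ^ j * (α - ρ α) * Θ (dualGen ρ Θ α (jE ϖ ^ j) h x₀)))) =
        μ / (jE ϖ ^ j * (α - ρ α) * Θ (dualGen ρ Θ α (jE ϖ ^ j) h x₀)) + ρ (μ / (jE ϖ ^ j * (α - ρ α) * Θ (dualGen ρ Θ α (jE ϖ ^ j) h x₀))) := by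
      rw [map_add, hρρ, add_comm]
    obtain ⟨e₀, he₀⟩ := (hjfix _).1 hfix
    exact (valueSet_flip_of_line_sizes hD H₂ hW jE hjv hjiso hjfix hρρ hvρ hα hα1 hΘΘ hΘρ hvΘ hΘj φ hφs hφγ hh hΘh hform hpr (hintL L₃ hL) hLB.symm hg₀ hg₀1
      hprg u hc hc0 hc1 hcc hx₀ hBΛ hΛx hw₀Y hyO hε' hσ' h1' hN' hpr' (hintL L₃' hL') hLB'.symm hg₀' hg₀1' hprg' hB'Λ' hΛx' hw₀Y' hylev hcb hμle hanti g1 g2 g3 hn gsk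
      hΘlam hvlam huu he₀ hlamn hun).2
  -- the face
  intro ε ξ ⟨ξ₀, hε, hσξ, hξN⟩ hεξ hρξ hξv1
  have hjξ1 : Valued.v (jE ξ₀) = 1 := by rw [← hε, hεξ]; exact hξv1
  have hξ01 : Valued.v ξ₀ = 1 := by rw [← hjiso]; exact hjξ1
  have hρjξ : ρ (jE ξ₀) = jE ξ₀ := (hjfix _).2 ⟨ξ₀, rfl⟩
  have hjξ0 : jE ξ₀ ≠ 0 := fun h0 => by rw [h0, map_zero] at hjξ1; exact zero_ne_one hjξ1
  have hε0 : ε ≠ 0 := fun h0 => hjξ0 (by rw [← hε, h0, zero_mul])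
  -- the inverse flip
  have hεi : ε⁻¹ * Θ ε⁻¹ = jE ξ₀⁻¹ := by rw [map_inv₀, ← mul_inv, hε, map_inv₀]
  have hρjξi : ρ (jE ξ₀⁻¹) = jE ξ₀⁻¹ := (hjfix _).2 ⟨ξ₀⁻¹, rfl⟩
  have hjξi1 : Valued.v (jE ξ₀⁻¹) = 1 := by rw [map_inv₀, map_inv₀, hjξ1, inv_one]
  constructor
  · rintro Λ hΛ ⟨B, hBΛ, L₃, hL, hLB, htube, hVS⟩
    have hΛ' : ε • Λ ∈ levelSetDep ρ Θ α (jE ϖ) h j b μ := (smul_mem_levelSetDep_iff_of_flip hε hρjξ hjξ1 (jE ϖ) h j b μ Λ).2 hΛ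
    obtain ⟨B', hB'Λ', L₃', hL', hLB', htube'⟩ := exists_glued_of_mem_levelSetDep_of_succ_le σ hσ hvσ hϖ hD h2v hH₂ hH₂σ hhW hhWσ jE hρρ hvρ hα hα1 hint
      hΘΘ hΘρ hvΘ hjv hjfix hjpow hϖmax φ hφs hφi hφo hφγ hlam hΘh hh hform ((u : Matrix (Fin 1) (Fin 1) E) 0 0) hb1 hbd hlamj hΛ'
    exact ⟨B', hB'Λ', L₃', hL', hLB', htube', (key ε ξ₀ hε hσξ hξ01 hξN Λ hΛ B L₃ hBΛ hL hLB htube B' L₃' hB'Λ' hL' hLB' htube').1 hVS⟩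
  · rintro Λ hΛ ⟨B, hBΛ, L₃, hL, hLB, htube, hnVS⟩
    have hΛ'' : ε⁻¹ • Λ ∈ levelSetDep ρ Θ α (jE ϖ) h j b μ := (smul_mem_levelSetDep_iff_of_flip hεi hρjξi hjξi1 (jE ϖ) h j b μ Λ).2 hΛ
    obtain ⟨B'', hB''Λ'', L₃'', hL'', hLB'', htube''⟩ := exists_glued_of_mem_levelSetDep_of_succ_le σ hσ hvσ hϖ hD h2v hH₂ hH₂σ hhW hhWσ jE hρρ hvρ hα hα1 hint
      hΘΘ hΘρ hvΘ hjv hjfix hjpow hϖmax φ hφs hφi hφo hφγ hlam hΘh hh hform ((u : Matrix (Fin 1) (Fin 1) E) 0 0) hb1 hbd hlamj hΛ''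
    refine ⟨B'', hB''Λ'', L₃'', hL'', hLB'', htube'', ?_⟩
    have hΛεε : ε • (ε⁻¹ • Λ) = Λ := by rw [smul_smul, mul_inv_cancel₀ hε0, one_smul]
    have k := key ε ξ₀ hε hσξ hξ01 hξN (ε⁻¹ • Λ) hΛ'' B'' L₃'' hB''Λ'' hL'' hLB'' htube'' B L₃ (by rw [hΛεε]; exact hBΛ) hL hLB htube
    exact k.2 hnVS

end Summit.HodgeConjecture.HodgeConjecture.Cruxes.H413.F0P3cDyRamLowerLineFlipFace

end
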